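import Summits.QuantumFields.YangMills.Theorems.UnitScaleTiltHalvingP1FlatCoreFrameLinTower
import HarnessLib

/-!
# The effective-gauge step in log coordinates — OSCILLATION-SENSITIVE form (J-N05♭ `core′`, induction brick F2a)

Sub-problem `YangMills` of summit `QuantumFields`; route `UnitScaleTilt`, line H = `BirthV10.stub_halvingStep`, pillar P1♭ `core′`
(LEAD-H T2♭-PLAN v1.1, rulings L-3/L-4/L-5; LEAD-H 11:30:32Z «the tower bookkeeping must run on the GENERAL step
✓`P1FlatCoreFrameLinTower.effGauge_step_eq_eml_G`»).  Helper file (`--supports stmt-QuantumFields-19200 --as helper`); it closes no item.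
HONEST LABEL: YM₃ on `T³` is rung R3 of the ladder, NOT the Clay problem; nothing here is a mass-gap statement.

## What this file adds

✓`P1FlatCoreFrameLinTower.norm_mlog_effGaugeStep_sub_siteAvg_le` bounds one step of the effective gauge map in log coordinates by
`700(δ + ℓ)·ℓ`, `ℓ` the SUP SIZE of `l = log κ_j` — not summable over `k` levels.  For the `k`-uniform rows (1.121)/(1.125) of the
family contraction (✓`B8SectEKLevelFamily`, `hC121`/`hC125`) the step error must be proportional to the block OSCILLATION
`m := max_i ‖l(x_i) − l(ȳ)‖` (geometric along the tower under the (1.120) gradient hypothesis), sizes only as prefactors: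
§1 one-sided / diagonal BCH remainder bounds (`‖bchLog (−X) Y − (Y − X)‖ ≤ 6a‖Y − X‖`); §2 the `W`-factor
`G = eml(s)·eml(hol·s)⁻¹·eml(hol)` of ✓`effGauge_step_eq_eml_G` in log letters, `≤ 9(η + 2σ)σ`; §3 the generic one-block step
`≤ 12(a+m)m + 2γ`; §4 ★ the torus instance for the double-bar tower of ANY level-0 field `W`:
`‖mlog κ_{i+1}(y) − siteAvg l y‖ ≤ 160·(a + δ + m)·m`, and `κ_{i+1} = exp ∘ mlog ∘ κ_{i+1}` (iterable).

[cite: Balaban1985RegularSpaces, Sect. E (1.120)-(1.125) pp.95-97; Balaban1985Averaging, (97)-(100) p.32, (110) p.34; Balaban1987RG1, (0.4) p.253]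
-/

noncomputable section
open NormedSpace
open Literature.MathematicalPhysics.QuantumFieldTheory.Balaban1983to89
open Literature.Analysis.Complex (mem_eball_expSeries_radius)
open T4Continuum BlockAveraging ExpMeanLog MatrixLog
open B10Eq27TorusAxialLog (holT gaugeActT)
open B7TransferAnalyticMean (meanCLM meanCLM_apply norm_meanCLM_apply_le)
open B12Membership313II (bchLog exp_bchLog norm_bchRem_sub_bchRem_le norm_expMul_sub_one_lt_one)
open BlockAveragingEMLAnalyticMean (eml_eq_exp_meanCLM)
open B7Prop1Explicit (units_val_inv_eq_exp_neg)
open Summit.QuantumFields.YangMills.Theorems.Prop8ChartDoubleBar (vframeU coe_vframeU dbarIterU)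
open Summit.QuantumFields.YangMills.Theorems.P1FlatCoreFrameLinBCH (meanCLM_const norm_meanCLM_le_of_forall_le bchLog_zero_left bchLog_zero_right)
open Summit.QuantumFields.YangMills.Theorems.P1FlatCoreFrameLin (coe_vframeU_eq_exp_meanCLM meanCLM_stairEnd_eq_siteAvg)
open Summit.QuantumFields.YangMills.Theorems.P1FlatCoreFrameLinTower (effGauge_step_eq_eml_G)

namespace Summit.QuantumFields.YangMills.Theorems.P1FlatCoreFrameLinOsc

variable {𝔸 : Type*} [NormedRing 𝔸] [NormedAlgebra ℂ 𝔸] [CompleteSpace 𝔸]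

/-! ## §1 One-sided and diagonal BCH remainder bounds -/

section BCH

/-- `bchLog (−X) X = 0` (`e^{−X}e^{X} = 1`, `log 1 = 0`). [folklore] -/
theorem bchLog_neg_self (X : 𝔸) : bchLog (-X) X = 0 := by
  show mlog (exp (-X) * exp X) = 0
  rw [← exp_add_of_commute_of_mem_ball (Commute.refl X).neg_left (mem_eball_expSeries_radius _)
    (mem_eball_expSeries_radius _), neg_add_cancel, exp_zero, mlog_one]

/-- **BCH REMAINDER, LEFT-PROPORTIONAL FORM**: `‖bchLog X Y − (X + Y)‖ ≤ 3(a + a′)·‖X‖` for `‖X‖ ≤ a`, `‖Y‖ ≤ a′`, `a + a′ ≤ 1/8`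
(the increment bound ✓`norm_bchRem_sub_bchRem_le` against the reference pair `(0, Y)`, where `bchLog 0 Y = Y` exactly). [folklore; cite: Balaban1985RegularSpaces, Sect. E p.95] -/
theorem norm_bchRem_le_left {X Y : 𝔸} {a a' : ℝ} (hX : ‖X‖ ≤ a) (hY : ‖Y‖ ≤ a') (hr : a + a' ≤ 1 / 8) :
    ‖bchLog X Y - (X + Y)‖ ≤ 3 * (a + a') * ‖X‖ := by
  have ha : 0 ≤ a := (norm_nonneg _).trans hX
  have hY2 : ‖Y‖ < Real.log 2 := by
    have : a' ≤ 1 / 8 := by linarith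
    linarith [Real.log_two_gt_d9]
  have h := norm_bchRem_sub_bchRem_le (X₂ := (0 : 𝔸)) (Y₂ := Y) hX (by rw [norm_zero]; exact ha) hY hY hr
  simpa only [bchLog_zero_left hY2, zero_add, sub_self, sub_zero, norm_zero, add_zero] using h

/-- **BCH REMAINDER, RIGHT-PROPORTIONAL FORM**: `‖bchLog X Y − (X + Y)‖ ≤ 3(a + a′)·‖Y‖` (reference pair `(X, 0)`, `bchLog X 0 = X`).
[folklore; cite: Balaban1985RegularSpaces, Sect. E p.95] -/
theorem norm_bchRem_le_right {X Y : 𝔸} {a a' : ℝ} (hX : ‖X‖ ≤ a) (hY : ‖Y‖ ≤ a') (hr : a + a' ≤ 1 / 8) :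
    ‖bchLog X Y - (X + Y)‖ ≤ 3 * (a + a') * ‖Y‖ := by
  have ha' : 0 ≤ a' := (norm_nonneg _).trans hY
  have hX2 : ‖X‖ < Real.log 2 := by
    have : a ≤ 1 / 8 := by linarith
    linarith [Real.log_two_gt_d9]
  have h := norm_bchRem_sub_bchRem_le (X₂ := X) (Y₂ := (0 : 𝔸)) hX hX hY (by rw [norm_zero]; exact ha') hr
  simpa only [bchLog_zero_right hX2, add_zero, sub_self, sub_zero, norm_zero, zero_add] using h

/-- `‖bchLog X Y‖ ≤ 2(a + a′)` for `‖X‖ ≤ a`, `‖Y‖ ≤ a′`, `a + a′ ≤ 1/8`. [folklore] -/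
theorem norm_bchLog_le_two_mul {X Y : 𝔸} {a a' : ℝ} (hX : ‖X‖ ≤ a) (hY : ‖Y‖ ≤ a') (hr : a + a' ≤ 1 / 8) :
    ‖bchLog X Y‖ ≤ 2 * (a + a') := by
  have ha : 0 ≤ a := (norm_nonneg _).trans hX
  have ha' : 0 ≤ a' := (norm_nonneg _).trans hY
  have h := norm_bchRem_le_right hX hY hr
  have h3 : 3 * (a + a') * ‖Y‖ ≤ a' := by nlinarith [norm_nonneg Y]
  calc ‖bchLog X Y‖ = ‖(bchLog X Y - (X + Y)) + (X + Y)‖ := by rw [sub_add_cancel]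
    _ ≤ ‖bchLog X Y - (X + Y)‖ + (‖X‖ + ‖Y‖) := (norm_add_le _ _).trans (by gcongr; exact norm_add_le _ _)
    _ ≤ 2 * (a + a') := by linarith

/-- **★ THE DIAGONAL FORM**: `‖bchLog (−X) Y − (Y − X)‖ ≤ 6a·‖Y − X‖` for `‖X‖, ‖Y‖ ≤ a`, `2a ≤ 1/8` — the relative log of two nearby
group elements is their log difference up to `size × distance` (increment bound against the diagonal pair `(−X, X)`, `bchLog (−X) X = 0`);
no `a²` term, which is what makes the tower bookkeeping run on OSCILLATIONS. [folklore; cite: Balaban1985RegularSpaces, Sect. E p.95] -/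
theorem norm_bchLog_neg_sub_le {X Y : 𝔸} {a : ℝ} (hX : ‖X‖ ≤ a) (hY : ‖Y‖ ≤ a) (hr : 2 * a ≤ 1 / 8) :
    ‖bchLog (-X) Y - (Y - X)‖ ≤ 6 * a * ‖Y - X‖ := by
  have hXn : ‖-X‖ ≤ a := by rwa [norm_neg]
  have h := norm_bchRem_sub_bchRem_le (X₁ := -X) (Y₁ := Y) (X₂ := -X) (Y₂ := X) hXn hXn hY hX (by linarith)
  simp only [bchLog_neg_self X, neg_add_cancel, sub_self, sub_zero, norm_zero, zero_add, neg_add_eq_sub] at h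
  calc ‖bchLog (-X) Y - (Y - X)‖ ≤ 3 * (a + a) * ‖Y - X‖ := h
    _ = 6 * a * ‖Y - X‖ := by ring

end BCH

/-! ## §2 The `W`-factor `G = eml(s)·eml(hol·s)⁻¹·eml(hol)` in log letters -/

section Gfactor

variable {ι : Type*} [Fintype ι] [Nonempty ι]

/-- **★ THE `W`-FACTOR IS `1` UP TO `(stair size + oscillation) × oscillation`**: for `H, S : ι → 𝔸` with `‖H_i‖ ≤ η`, `‖S_i‖ ≤ σ`,
`η + 3σ ≤ 1/16`, the logarithm `Γ := bchLog (bchLog S̄ (−mean_i bchLog(H_i, S_i))) H̄` of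
`G = e^{S̄} · (e^{mean_i bchLog(H_i,S_i)})⁻¹ · e^{H̄}` (`S̄ = mean S`, `H̄ = mean H`) satisfies `‖Γ‖ ≤ 9(η + 2σ)σ` — proportional to `σ`
(at `S ≡ 0` the factor is exactly `1`), with NO `η²` term; three product-form BCH remainders (§1), no second-order lemma.
(LEAD-H 11:30:32Z «FACTS ABOUT G».) [cite: Balaban1985Averaging, (110) p.34; Balaban1985RegularSpaces, Sect. E p.95] -/
theorem norm_bchLog_bchLog_le (H S : ι → 𝔸) {η σ : ℝ} (hH : ∀ i, ‖H i‖ ≤ η) (hS : ∀ i, ‖S i‖ ≤ σ) (hr : η + 3 * σ ≤ 1 / 16) :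
    ‖bchLog (bchLog (meanCLM ι 𝔸 S) (-(meanCLM ι 𝔸 fun i => bchLog (H i) (S i)))) (meanCLM ι 𝔸 H)‖ ≤ 9 * (η + 2 * σ) * σ := by
  have hη : 0 ≤ η := (norm_nonneg _).trans (hH (Classical.arbitrary ι))
  have hσ : 0 ≤ σ := (norm_nonneg _).trans (hS (Classical.arbitrary ι))
  have hησ : η * σ + 3 * (σ * σ) ≤ σ / 16 := by nlinarith [mul_nonneg hσ (sub_nonneg.2 hr)]
  have hηησ : 0 ≤ η * σ := mul_nonneg hη hσ
  have hσσ : 0 ≤ σ * σ := mul_nonneg hσ hσ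
  -- the inner remainders `ρ_i := bchLog H_i S_i − (H_i + S_i)`, `‖ρ_i‖ ≤ 3(η+σ)σ`, and their mean `P`
  set P : 𝔸 := meanCLM ι 𝔸 fun i => bchLog (H i) (S i) - (H i + S i) with hP
  have hPi : ∀ i, ‖bchLog (H i) (S i) - (H i + S i)‖ ≤ 3 * (η + σ) * σ := fun i =>
    (norm_bchRem_le_right (hH i) (hS i) (by linarith)).trans (mul_le_mul_of_nonneg_left (hS i) (by positivity))
  have hPn : ‖P‖ ≤ 3 * (η + σ) * σ := norm_meanCLM_le_of_forall_le _ (by positivity) hPi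
  set Sb : 𝔸 := meanCLM ι 𝔸 S with hSb
  set Hb : 𝔸 := meanCLM ι 𝔸 H with hHb
  have hSbn : ‖Sb‖ ≤ σ := norm_meanCLM_le_of_forall_le _ hσ hS
  have hHbn : ‖Hb‖ ≤ η := norm_meanCLM_le_of_forall_le _ hη hH
  have hM : (meanCLM ι 𝔸 fun i => bchLog (H i) (S i)) = Hb + Sb + P := by
    have hfun : (fun i => bchLog (H i) (S i)) = (fun i => bchLog (H i) (S i) - (H i + S i)) + (H + S) := by
      funext i; simp only [Pi.add_apply, sub_add_cancel]
    rw [hfun, map_add, map_add, ← hP, ← hHb, ← hSb]; abel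
  rw [hM]
  -- the first outer remainder: `T := bchLog S̄ (−(H̄ + S̄ + P)) = −H̄ − P + r₁`, `‖r₁‖ ≤ 3(η + 3σ)σ`
  have hY : ‖-(Hb + Sb + P)‖ ≤ η + 2 * σ := by
    rw [norm_neg]
    calc ‖Hb + Sb + P‖ ≤ ‖Hb‖ + ‖Sb‖ + ‖P‖ := norm_add₃_le
      _ ≤ η + σ + 3 * (η + σ) * σ := by linarith
      _ ≤ η + 2 * σ := by nlinarith
  have hr1 : ‖bchLog Sb (-(Hb + Sb + P)) - (Sb + -(Hb + Sb + P))‖ ≤ 3 * (σ + (η + 2 * σ)) * ‖Sb‖ :=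
    norm_bchRem_le_left hSbn hY (by linarith)
  set T : 𝔸 := bchLog Sb (-(Hb + Sb + P)) with hT
  have hu : ‖T + Hb + P‖ ≤ 3 * (η + 3 * σ) * σ := by
    have : T + Hb + P = T - (Sb + -(Hb + Sb + P)) := by abel
    rw [this]
    calc ‖T - (Sb + -(Hb + Sb + P))‖ ≤ 3 * (σ + (η + 2 * σ)) * ‖Sb‖ := hr1
      _ ≤ 3 * (σ + (η + 2 * σ)) * σ := mul_le_mul_of_nonneg_left hSbn (by positivity)
      _ = 3 * (η + 3 * σ) * σ := by ring
  have hTn : ‖T‖ ≤ η + σ := by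
    have : T = (T + Hb + P) - Hb - P := by abel
    rw [this]
    calc ‖(T + Hb + P) - Hb - P‖ ≤ ‖(T + Hb + P) - Hb‖ + ‖P‖ := norm_sub_le _ _
      _ ≤ ‖T + Hb + P‖ + ‖Hb‖ + ‖P‖ := by linarith [norm_sub_le (T + Hb + P) Hb]
      _ ≤ 3 * (η + 3 * σ) * σ + η + 3 * (η + σ) * σ := by linarith
      _ ≤ η + σ := by nlinarith
  -- the second outer remainder: `bchLog T H̄ − (T + H̄)`, reference pair `(−H̄, H̄)`
  have hHbn' : ‖-Hb‖ ≤ η + σ := by rw [norm_neg]; linarith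
  have hr2 := norm_bchRem_sub_bchRem_le (X₁ := T) (Y₁ := Hb) (X₂ := -Hb) (Y₂ := Hb) hTn hHbn' hHbn hHbn (by linarith)
  simp only [bchLog_neg_self Hb, neg_add_cancel, sub_self, sub_zero, norm_zero, add_zero, sub_neg_eq_add] at hr2
  -- `hr2 : ‖bchLog T Hb - (T + Hb)‖ ≤ 3 * (η + σ + η) * ‖T + Hb‖`
  have hTH : ‖T + Hb‖ ≤ ‖T + Hb + P‖ + ‖P‖ := by
    have : T + Hb = (T + Hb + P) - P := by abel
    calc ‖T + Hb‖ = ‖(T + Hb + P) - P‖ := by rw [← this]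
      _ ≤ ‖T + Hb + P‖ + ‖P‖ := norm_sub_le _ _
  have h38 : 3 * (η + σ + η) ≤ 3 / 8 := by linarith
  have hfin : bchLog T Hb = (bchLog T Hb - (T + Hb)) + (T + Hb + P) + -P := by abel
  rw [hfin]
  calc ‖(bchLog T Hb - (T + Hb)) + (T + Hb + P) + -P‖ ≤ ‖bchLog T Hb - (T + Hb)‖ + ‖T + Hb + P‖ + ‖-P‖ := norm_add₃_le
    _ ≤ 3 * (η + σ + η) * (‖T + Hb + P‖ + ‖P‖) + ‖T + Hb + P‖ + ‖P‖ := by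
        rw [norm_neg]
        have := hr2.trans (mul_le_mul_of_nonneg_left hTH (by positivity))
        linarith
    _ ≤ 3 / 8 * (‖T + Hb + P‖ + ‖P‖) + ‖T + Hb + P‖ + ‖P‖ := by
        have := mul_le_mul_of_nonneg_right h38 (by positivity : (0 : ℝ) ≤ ‖T + Hb + P‖ + ‖P‖)
        linarith
    _ ≤ 9 * (η + 2 * σ) * σ := by nlinarith

end Gfactor

/-! ## §3 The generic one-block step -/

section Step

variable {ι : Type*} [Fintype ι] [Nonempty ι]

/-- **★★ THE ONE-BLOCK STEP IN LOG COORDINATES, OSCILLATION-SENSITIVE**: centre log `A`, stair-end logs `B_i` (`‖A‖, ‖B_i‖ ≤ a`,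
`‖B_i − A‖ ≤ m`), relative logs `S_i := bchLog(−B_i, A)`, `S̄ := mean S`, any `Γ` with `‖Γ‖ ≤ γ`, `2a + 2m + γ ≤ 1/8`:
`‖bchLog (bchLog A (−S̄)) Γ − mean_i B_i‖ ≤ 12(a + m)·m + 2γ` (§1 diagonal form inside the mean, right-proportional form for the two outer
products; the centre value cancels exactly, ✓`meanCLM_const`). [cite: Balaban1985RegularSpaces, Sect. E (1.121) p.96; Balaban1985Averaging, (110) p.34] -/
theorem norm_bchLog_step_sub_mean_le (A : 𝔸) (B : ι → 𝔸) (Γ : 𝔸) {a m γ : ℝ} (hA : ‖A‖ ≤ a) (hB : ∀ i, ‖B i‖ ≤ a)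
    (hm : ∀ i, ‖B i - A‖ ≤ m) (hΓ : ‖Γ‖ ≤ γ) (hr : 2 * a + 2 * m + γ ≤ 1 / 8) :
    ‖bchLog (bchLog A (-(meanCLM ι 𝔸 fun i => bchLog (-(B i)) A))) Γ - meanCLM ι 𝔸 B‖ ≤ 12 * (a + m) * m + 2 * γ := by
  have ha : 0 ≤ a := (norm_nonneg _).trans hA
  have hm0 : 0 ≤ m := (norm_nonneg _).trans (hm (Classical.arbitrary ι))
  have hγ : 0 ≤ γ := (norm_nonneg _).trans hΓ
  have ham : 0 ≤ a * m := mul_nonneg ha hm0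
  have hmm : 0 ≤ m * m := mul_nonneg hm0 hm0
  -- relative logs `S_i := bchLog (−B_i) A`, within `6a·m` of `A − B_i`
  have hSi : ∀ i, ‖bchLog (-(B i)) A - (A - B i)‖ ≤ 6 * a * m := fun i =>
    (norm_bchLog_neg_sub_le (hB i) hA (by linarith)).trans
      (mul_le_mul_of_nonneg_left (by rw [norm_sub_rev]; exact hm i) (by positivity))
  have hlin : A - meanCLM ι 𝔸 B = meanCLM ι 𝔸 fun i => A - B i := by
    have hfun : (fun i => A - B i) = (fun _ => A) - B := rfl
    rw [hfun, map_sub, meanCLM_const]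
  set Sb : 𝔸 := meanCLM ι 𝔸 fun i => bchLog (-(B i)) A with hSb
  have hdev : ‖Sb - (A - meanCLM ι 𝔸 B)‖ ≤ 6 * a * m := by
    rw [hlin, hSb, ← map_sub]
    exact norm_meanCLM_le_of_forall_le _ (by positivity) fun i => hSi i
  have h1 : ‖A - meanCLM ι 𝔸 B‖ ≤ m := by
    rw [hlin]
    exact norm_meanCLM_le_of_forall_le _ hm0 fun i => by rw [norm_sub_rev]; exact hm i
  have h6 : 6 * a * m ≤ m := by nlinarith
  have hSbn : ‖Sb‖ ≤ 2 * m := by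
    calc ‖Sb‖ = ‖(Sb - (A - meanCLM ι 𝔸 B)) + (A - meanCLM ι 𝔸 B)‖ := by rw [sub_add_cancel]
      _ ≤ 6 * a * m + m := (norm_add_le _ _).trans (add_le_add hdev h1)
      _ ≤ 2 * m := by linarith
  -- first outer product: `Z := bchLog A (−S̄) = A − S̄ + r`, `‖r‖ ≤ 3(a + 2m)·2m`
  have hnSb : ‖-Sb‖ ≤ 2 * m := by rwa [norm_neg]
  have hrZ : ‖bchLog A (-Sb) - (A + -Sb)‖ ≤ 3 * (a + 2 * m) * ‖-Sb‖ := norm_bchRem_le_right hA hnSb (by linarith)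
  set Z : 𝔸 := bchLog A (-Sb) with hZ
  have hZdev : ‖Z - meanCLM ι 𝔸 B‖ ≤ 12 * (a + m) * m := by
    have : Z - meanCLM ι 𝔸 B = (Z - (A + -Sb)) - (Sb - (A - meanCLM ι 𝔸 B)) := by abel
    rw [this]
    calc ‖(Z - (A + -Sb)) - (Sb - (A - meanCLM ι 𝔸 B))‖ ≤ ‖Z - (A + -Sb)‖ + ‖Sb - (A - meanCLM ι 𝔸 B)‖ := norm_sub_le _ _
      _ ≤ 3 * (a + 2 * m) * (2 * m) + 6 * a * m :=
          add_le_add (hrZ.trans (mul_le_mul_of_nonneg_left hnSb (by positivity))) hdev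
      _ = 12 * (a + m) * m := by ring
  have hZn : ‖Z‖ ≤ a + 2 * m := by
    have hBn : ‖meanCLM ι 𝔸 B‖ ≤ a := norm_meanCLM_le_of_forall_le _ ha hB
    have h12 : 12 * (a + m) * m ≤ 2 * m := by nlinarith
    calc ‖Z‖ = ‖(Z - meanCLM ι 𝔸 B) + meanCLM ι 𝔸 B‖ := by rw [sub_add_cancel]
      _ ≤ 12 * (a + m) * m + a := (norm_add_le _ _).trans (add_le_add hZdev hBn)
      _ ≤ a + 2 * m := by linarith
  -- second outer product with `Γ`
  have hrG : ‖bchLog Z Γ - (Z + Γ)‖ ≤ 3 * ((a + 2 * m) + γ) * ‖Γ‖ := norm_bchRem_le_right hZn hΓ (by linarith)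
  have hfin : bchLog Z Γ - meanCLM ι 𝔸 B = (bchLog Z Γ - (Z + Γ)) + (Z - meanCLM ι 𝔸 B) + Γ := by abel
  rw [hfin]
  have hγγ : 3 * ((a + 2 * m) + γ) * γ ≤ γ := by nlinarith
  calc ‖(bchLog Z Γ - (Z + Γ)) + (Z - meanCLM ι 𝔸 B) + Γ‖ ≤ ‖bchLog Z Γ - (Z + Γ)‖ + ‖Z - meanCLM ι 𝔸 B‖ + ‖Γ‖ := norm_add₃_le
    _ ≤ 3 * ((a + 2 * m) + γ) * γ + 12 * (a + m) * m + γ :=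
        add_le_add_three (hrG.trans (mul_le_mul_of_nonneg_left hΓ (by positivity))) hZdev hΓ
    _ ≤ 12 * (a + m) * m + 2 * γ := by linarith

end Step

/-! ## §4 The torus instance: one step of the effective gauge map of the double-bar tower of a general field -/

section Torus

variable {P : Params}

open LatticeFieldCalculus (siteAvg)

/-- **★★ ONE STEP OF THE EFFECTIVE GAUGE MAP AS ONE EXPONENTIAL, OSCILLATION-SENSITIVE, GENERAL FIELD**: for the effective gauges `κ`
of the double-bar tower of a level-`0` field `W` (recursion `κ_{i+1}(y) = v(X_i^{κ_i})(y)⁻¹ κ_i(ȳ) v(X_i)(y)`, `X_i = U̿^{(i)}W`, ✓`exists_effGauge`),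
`κ_i = exp ∘ l` with `‖l‖ ≤ a` at the centre and the stair ends of the block of `y`, oscillation `‖l(x_idx) − l(ȳ)‖ ≤ m`, stairs within `δ` of `1`,
`2a + 4δ + 8m ≤ 1/16`:  `κ_{i+1}(y) = e^{Λ}`, `‖Λ − siteAvg l y‖ ≤ 160·(a + δ + m)·m`, `‖Λ‖ ≤ a + 5m` — error ∝ the OSCILLATION `m`
(compare ✓`norm_mlog_effGaugeStep_sub_siteAvg_le`: `700(δ+ℓ)ℓ`).  Exact step ✓`effGauge_step_eq_eml_G`; §3 for the outer products, §2 for `G`.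
[cite: Balaban1985RegularSpaces, Sect. E (1.120)-(1.121) pp.95-96; Balaban1985Averaging, (97)-(100) p.32, (110) p.34] -/
theorem exists_effGauge_succ_eq_exp [Nonempty (Idx P)] (W : GaugeField P 0 𝔸ˣ) (κ : (i : ℕ) → GaugeTransf P i 𝔸ˣ)
    (hs : ∀ (i : ℕ) (y : Site P (i + 1)),
      κ (i + 1) y = (vframeU (gaugeActT (κ i) (dbarIterU i W)) y)⁻¹ * κ i (emb y) * vframeU (dbarIterU i W) y)
    (i : ℕ) (y : Site P (i + 1)) (l : Site P i → 𝔸) (hκ : ∀ x, ((κ i x : 𝔸ˣ) : 𝔸) = exp (l x)) {δ a m : ℝ} (hδ : 0 ≤ δ)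
    (hH : ∀ idx : Idx P, ‖((holT (dbarIterU i W) (emb y) (stairWord idx.2.1 (off idx.1)) : 𝔸ˣ) : 𝔸) - 1‖ ≤ δ)
    (ha : ‖l (emb y)‖ ≤ a) (hb : ∀ idx : Idx P, ‖l (walkEnd (emb y) (stairWord idx.2.1 (off idx.1)))‖ ≤ a)
    (hm : ∀ idx : Idx P, ‖l (walkEnd (emb y) (stairWord idx.2.1 (off idx.1))) - l (emb y)‖ ≤ m)
    (hr : 2 * a + 4 * δ + 8 * m ≤ 1 / 16) :
    ∃ Λ : 𝔸, ((κ (i + 1) y : 𝔸ˣ) : 𝔸) = exp Λ ∧ ‖Λ - siteAvg l y‖ ≤ 160 * (a + δ + m) * m ∧ ‖Λ‖ ≤ a + 5 * m := by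
  have ha0 : 0 ≤ a := (norm_nonneg _).trans ha
  have hm0 : 0 ≤ m := (norm_nonneg _).trans (hm (Classical.arbitrary (Idx P)))
  -- letters: `A` centre log, `B idx` stair-end logs, `Hl idx` stair logs, `S idx` relative logs
  set A : 𝔸 := l (emb y) with hA
  have hBA : ∀ idx : Idx P, (((κ i (walkEnd (emb y) (stairWord idx.2.1 (off idx.1))))⁻¹ * κ i (emb y) : 𝔸ˣ) : 𝔸) =
      exp (-(l (walkEnd (emb y) (stairWord idx.2.1 (off idx.1))))) * exp A := fun idx => by
    rw [Units.val_mul, units_val_inv_eq_exp_neg (hκ _), hκ]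
  have hS6 : ∀ idx : Idx P, ‖bchLog (-(l (walkEnd (emb y) (stairWord idx.2.1 (off idx.1))))) A -
      (A - l (walkEnd (emb y) (stairWord idx.2.1 (off idx.1))))‖ ≤ 6 * a * m := fun idx =>
    (norm_bchLog_neg_sub_le (hb idx) ha (by linarith)).trans
      (mul_le_mul_of_nonneg_left (by rw [norm_sub_rev]; exact hm idx) (by positivity))
  have hSn : ∀ idx : Idx P, ‖bchLog (-(l (walkEnd (emb y) (stairWord idx.2.1 (off idx.1))))) A‖ ≤ 2 * m := fun idx => by
    have h6 : 6 * a * m ≤ m := by nlinarith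
    have hd : ‖A - l (walkEnd (emb y) (stairWord idx.2.1 (off idx.1)))‖ ≤ m := by rw [norm_sub_rev]; exact hm idx
    calc _ = ‖(bchLog (-(l (walkEnd (emb y) (stairWord idx.2.1 (off idx.1))))) A -
          (A - l (walkEnd (emb y) (stairWord idx.2.1 (off idx.1))))) + (A - l (walkEnd (emb y) (stairWord idx.2.1 (off idx.1))))‖ := by
            rw [sub_add_cancel]
      _ ≤ 6 * a * m + m := (norm_add_le _ _).trans (add_le_add (hS6 idx) hd)
      _ ≤ 2 * m := by linarith
  have hHn : ∀ idx : Idx P, ‖mlog ((holT (dbarIterU i W) (emb y) (stairWord idx.2.1 (off idx.1)) : 𝔸ˣ) : 𝔸)‖ ≤ 2 * δ := fun idx =>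
    (norm_mlog_le_two_mul ((hH idx).trans (by linarith))).trans (by linarith [hH idx])
  set Sb : 𝔸 := meanCLM (Idx P) 𝔸 fun idx : Idx P => bchLog (-(l (walkEnd (emb y) (stairWord idx.2.1 (off idx.1))))) A with hSb
  set M : 𝔸 := meanCLM (Idx P) 𝔸 fun idx : Idx P =>
      bchLog (mlog ((holT (dbarIterU i W) (emb y) (stairWord idx.2.1 (off idx.1)) : 𝔸ˣ) : 𝔸))
        (bchLog (-(l (walkEnd (emb y) (stairWord idx.2.1 (off idx.1))))) A) with hM
  set Hb : 𝔸 := meanCLM (Idx P) 𝔸 fun idx : Idx P => mlog ((holT (dbarIterU i W) (emb y) (stairWord idx.2.1 (off idx.1)) : 𝔸ˣ) : 𝔸)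
    with hHb
  have hSbn : ‖Sb‖ ≤ 2 * m := norm_meanCLM_le_of_forall_le _ (by positivity) hSn
  have hHbn : ‖Hb‖ ≤ 2 * δ := norm_meanCLM_le_of_forall_le _ (by positivity) hHn
  have hMn : ‖M‖ ≤ 2 * (2 * δ + 2 * m) :=
    norm_meanCLM_le_of_forall_le _ (by positivity) fun idx => norm_bchLog_le_two_mul (hHn idx) (hSn idx) (by linarith)
  have hemlS : eml (fun idx : Idx P => (((κ i (walkEnd (emb y) (stairWord idx.2.1 (off idx.1))))⁻¹ * κ i (emb y) : 𝔸ˣ) : 𝔸)) =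
      exp Sb := by
    rw [eml_eq_exp_meanCLM, hSb]
    congr 1; congr 1; funext idx
    rw [hBA idx]; rfl
  have hemlHS : eml (fun idx : Idx P => ((holT (dbarIterU i W) (emb y) (stairWord idx.2.1 (off idx.1)) : 𝔸ˣ) : 𝔸) *
      (((κ i (walkEnd (emb y) (stairWord idx.2.1 (off idx.1))))⁻¹ * κ i (emb y) : 𝔸ˣ) : 𝔸)) = exp M := by
    rw [eml_eq_exp_meanCLM, hM]
    congr 1; congr 1; funext idx
    have h1 : ‖((holT (dbarIterU i W) (emb y) (stairWord idx.2.1 (off idx.1)) : 𝔸ˣ) : 𝔸) - 1‖ < 1 := (hH idx).trans_lt (by linarith)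
    have h2 : ‖-(l (walkEnd (emb y) (stairWord idx.2.1 (off idx.1))))‖ + ‖A‖ ≤ 1 / 4 := by rw [norm_neg]; linarith [hb idx]
    rw [hBA idx, ← exp_bchLog (norm_expMul_sub_one_lt_one h2)]
    conv_lhs => rw [← exp_mlog h1]
    rfl
  have hv : ((vframeU (dbarIterU i W) y : 𝔸ˣ) : 𝔸) = exp Hb := by rw [hHb]; exact coe_vframeU_eq_exp_meanCLM _ y
  have hU : (((isUnit_eml (fun idx : Idx P =>
      (((κ i (walkEnd (emb y) (stairWord idx.2.1 (off idx.1))))⁻¹ * κ i (emb y) : 𝔸ˣ) : 𝔸))).unit : 𝔸ˣ) : 𝔸) = exp Sb := by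
    rw [IsUnit.unit_spec, hemlS]
  have hV : (((isUnit_eml (fun idx : Idx P => ((holT (dbarIterU i W) (emb y) (stairWord idx.2.1 (off idx.1)) : 𝔸ˣ) : 𝔸) *
      (((κ i (walkEnd (emb y) (stairWord idx.2.1 (off idx.1))))⁻¹ * κ i (emb y) : 𝔸ˣ) : 𝔸))).unit : 𝔸ˣ) : 𝔸) = exp M := by
    rw [IsUnit.unit_spec, hemlHS]
  -- the step as a product of exponentials, then as a two-fold BCH logarithm
  have hkey : ((κ (i + 1) y : 𝔸ˣ) : 𝔸) = exp A * exp (-Sb) * (exp Sb * exp (-M) * exp Hb) := by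
    rw [effGauge_step_eq_eml_G W κ hs i y, Units.val_mul, Units.val_mul, Units.val_mul, Units.val_mul,
      units_val_inv_eq_exp_neg hU, units_val_inv_eq_exp_neg hV, hU, hv, hκ]
  have h1 : ‖Sb‖ + ‖-M‖ ≤ 1 / 4 := by rw [norm_neg]; linarith
  have hTn : ‖bchLog Sb (-M)‖ ≤ 2 * (2 * m + 2 * (2 * δ + 2 * m)) :=
    norm_bchLog_le_two_mul hSbn (by rw [norm_neg]; exact hMn) (by linarith)
  have h2 : ‖bchLog Sb (-M)‖ + ‖Hb‖ ≤ 1 / 4 := by linarith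
  have h3 : ‖A‖ + ‖-Sb‖ ≤ 1 / 4 := by rw [norm_neg]; linarith
  -- the `W`-factor (§2) and the step (§3)
  have hG : ‖bchLog (bchLog Sb (-M)) Hb‖ ≤ 9 * (2 * δ + 2 * (2 * m)) * (2 * m) := by
    rw [hSb, hM, hHb]
    exact norm_bchLog_bchLog_le (ι := Idx P)
      (fun idx : Idx P => mlog ((holT (dbarIterU i W) (emb y) (stairWord idx.2.1 (off idx.1)) : 𝔸ˣ) : 𝔸))
      (fun idx : Idx P => bchLog (-(l (walkEnd (emb y) (stairWord idx.2.1 (off idx.1))))) A) hHn hSn (by linarith)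
  have hγm : 9 * (2 * δ + 2 * (2 * m)) * (2 * m) ≤ m := by nlinarith
  have hZn : ‖bchLog A (-Sb)‖ ≤ 2 * (a + 2 * m) := norm_bchLog_le_two_mul ha (by rw [norm_neg]; exact hSbn) (by linarith)
  have h4 : ‖bchLog A (-Sb)‖ + ‖bchLog (bchLog Sb (-M)) Hb‖ ≤ 1 / 4 := by linarith
  have hstep := norm_bchLog_step_sub_mean_le (ι := Idx P) A
    (fun idx : Idx P => l (walkEnd (emb y) (stairWord idx.2.1 (off idx.1)))) (bchLog (bchLog Sb (-M)) Hb)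
    ha hb hm hG (by linarith)
  rw [← hSb, meanCLM_stairEnd_eq_siteAvg l y] at hstep
  have hδm : 0 ≤ δ * m := mul_nonneg hδ hm0
  have hmm : 0 ≤ m * m := mul_nonneg hm0 hm0
  have ham : 0 ≤ a * m := mul_nonneg ha0 hm0
  have hdev : ‖bchLog (bchLog A (-Sb)) (bchLog (bchLog Sb (-M)) Hb) - siteAvg l y‖ ≤ 160 * (a + δ + m) * m :=
    calc _ ≤ 12 * (a + m) * m + 2 * (9 * (2 * δ + 2 * (2 * m)) * (2 * m)) := hstep
      _ ≤ 160 * (a + δ + m) * m := by nlinarith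
  have havg : ‖siteAvg l y‖ ≤ a := by
    rw [← meanCLM_stairEnd_eq_siteAvg l y]; exact norm_meanCLM_le_of_forall_le _ ha0 hb
  refine ⟨bchLog (bchLog A (-Sb)) (bchLog (bchLog Sb (-M)) Hb), ?_, hdev, ?_⟩
  · rw [hkey, ← exp_bchLog (norm_expMul_sub_one_lt_one h1), ← exp_bchLog (norm_expMul_sub_one_lt_one h2),
      ← exp_bchLog (norm_expMul_sub_one_lt_one h3), ← exp_bchLog (norm_expMul_sub_one_lt_one h4)]
  · have h5 : 160 * (a + δ + m) * m ≤ 5 * m := by nlinarith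
    calc _ = ‖(bchLog (bchLog A (-Sb)) (bchLog (bchLog Sb (-M)) Hb) - siteAvg l y) + siteAvg l y‖ := by rw [sub_add_cancel]
      _ ≤ 160 * (a + δ + m) * m + a := (norm_add_le _ _).trans (add_le_add hdev havg)
      _ ≤ a + 5 * m := by linarith

/-- **★★ ONE STEP OF THE EFFECTIVE GAUGE MAP IN LOG COORDINATES, OSCILLATION-SENSITIVE, GENERAL FIELD**: under the hypotheses of
✓`exists_effGauge_succ_eq_exp`, `‖log κ_{i+1}(y) − siteAvg l y‖ ≤ 160·(a + δ + m)·m` (`log` = ✓`MatrixLog.mlog`; `mlog (exp Λ) = Λ` since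
`‖Λ‖ ≤ a + 5m < ln 2`). [cite: Balaban1985RegularSpaces, Sect. E (1.120)-(1.121) pp.95-96; Balaban1985Averaging, (110) p.34] -/
theorem norm_mlog_effGauge_succ_sub_siteAvg_le [Nonempty (Idx P)] (W : GaugeField P 0 𝔸ˣ) (κ : (i : ℕ) → GaugeTransf P i 𝔸ˣ)
    (hs : ∀ (i : ℕ) (y : Site P (i + 1)),
      κ (i + 1) y = (vframeU (gaugeActT (κ i) (dbarIterU i W)) y)⁻¹ * κ i (emb y) * vframeU (dbarIterU i W) y)
    (i : ℕ) (y : Site P (i + 1)) (l : Site P i → 𝔸) (hκ : ∀ x, ((κ i x : 𝔸ˣ) : 𝔸) = exp (l x)) {δ a m : ℝ} (hδ : 0 ≤ δ)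
    (hH : ∀ idx : Idx P, ‖((holT (dbarIterU i W) (emb y) (stairWord idx.2.1 (off idx.1)) : 𝔸ˣ) : 𝔸) - 1‖ ≤ δ)
    (ha : ‖l (emb y)‖ ≤ a) (hb : ∀ idx : Idx P, ‖l (walkEnd (emb y) (stairWord idx.2.1 (off idx.1)))‖ ≤ a)
    (hm : ∀ idx : Idx P, ‖l (walkEnd (emb y) (stairWord idx.2.1 (off idx.1))) - l (emb y)‖ ≤ m)
    (hr : 2 * a + 4 * δ + 8 * m ≤ 1 / 16) :
    ‖mlog ((κ (i + 1) y : 𝔸ˣ) : 𝔸) - siteAvg l y‖ ≤ 160 * (a + δ + m) * m := by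
  obtain ⟨Λ, hΛ, hdev, hΛn⟩ := exists_effGauge_succ_eq_exp W κ hs i y l hκ hδ hH ha hb hm hr
  have hm0 : 0 ≤ m := (norm_nonneg _).trans (hm (Classical.arbitrary (Idx P)))
  have hlt : ‖Λ‖ < Real.log 2 := by linarith [Real.log_two_gt_d9, norm_nonneg (l (emb y))]
  rw [hΛ, B7BlockAvgLog.mlog_exp hlt]
  exact hdev

/-- **THE NEXT LEVEL'S GAUGE IS AGAIN `exp ∘ log`** (so the step iterates with `l_{i+1} := log ∘ κ_{i+1}`): `exp (mlog κ_{i+1}(y)) = κ_{i+1}(y)`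
and `‖mlog κ_{i+1}(y)‖ ≤ a + 5m`, under the hypotheses of ✓`exists_effGauge_succ_eq_exp`. [cite: Balaban1985Averaging, (97)-(100) p.32] -/
theorem exp_mlog_effGauge_succ [Nonempty (Idx P)] (W : GaugeField P 0 𝔸ˣ) (κ : (i : ℕ) → GaugeTransf P i 𝔸ˣ)
    (hs : ∀ (i : ℕ) (y : Site P (i + 1)),
      κ (i + 1) y = (vframeU (gaugeActT (κ i) (dbarIterU i W)) y)⁻¹ * κ i (emb y) * vframeU (dbarIterU i W) y)
    (i : ℕ) (y : Site P (i + 1)) (l : Site P i → 𝔸) (hκ : ∀ x, ((κ i x : 𝔸ˣ) : 𝔸) = exp (l x)) {δ a m : ℝ} (hδ : 0 ≤ δ)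
    (hH : ∀ idx : Idx P, ‖((holT (dbarIterU i W) (emb y) (stairWord idx.2.1 (off idx.1)) : 𝔸ˣ) : 𝔸) - 1‖ ≤ δ)
    (ha : ‖l (emb y)‖ ≤ a) (hb : ∀ idx : Idx P, ‖l (walkEnd (emb y) (stairWord idx.2.1 (off idx.1)))‖ ≤ a)
    (hm : ∀ idx : Idx P, ‖l (walkEnd (emb y) (stairWord idx.2.1 (off idx.1))) - l (emb y)‖ ≤ m)
    (hr : 2 * a + 4 * δ + 8 * m ≤ 1 / 16) :
    exp (mlog ((κ (i + 1) y : 𝔸ˣ) : 𝔸)) = ((κ (i + 1) y : 𝔸ˣ) : 𝔸) ∧ ‖mlog ((κ (i + 1) y : 𝔸ˣ) : 𝔸)‖ ≤ a + 5 * m := by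
  obtain ⟨Λ, hΛ, -, hΛn⟩ := exists_effGauge_succ_eq_exp W κ hs i y l hκ hδ hH ha hb hm hr
  have hm0 : 0 ≤ m := (norm_nonneg _).trans (hm (Classical.arbitrary (Idx P)))
  have hlt : ‖Λ‖ < Real.log 2 := by linarith [Real.log_two_gt_d9, norm_nonneg (l (emb y))]
  rw [hΛ, B7BlockAvgLog.mlog_exp hlt]
  exact ⟨rfl, hΛn⟩

end Torus

end Summit.QuantumFields.YangMills.Theorems.P1FlatCoreFrameLinOsc

end
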